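import Summits.QuantumFields.BalabanUV.Beta.SymWardLettersAn1

/-!
# `BalabanUV.Beta.CombMixedT2SiteLetter` — binder row D1, the DICTIONARY's ORDER-2 MIXED LETTER (T2-M₂) for road «FP», PER FINE SITE:
# **THE LITERAL's SECOND-ORDER MIXED TABLE `M2Of 3 Lc (symMixFFAt ρ_c Lc) j` OBEYS, AT EVERY FINE SITE `u₀`, THE GAUGE LETTER AGAINST THE MULTIPLIER TABLE
# `M1Of 3 Lc (symHessFFAt ρ_c Lc) cΛ j` WITH THE CHAIN's GENERATOR `½ • legInd ρ_c u₀` AND PREFACTOR `c_j = (stepScale_j·Lc⁴)⁻¹`, UP TO AN EXPLICIT PER-SITE REMAINDER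
# — AT THE Λ-LOCK `cΛ·Lc⁴ = 2`: `(wM1_j∕Lc⁴) • (2·[u₀ = Lc•w + ρ_c] • H − H∘D − D∘H)`, `H = symHessFFAt ρ_c Lc ρ′ w`, `D = diagK (legInd ρ_c u₀)` — WHICH IS FIELD–FIELD
# SUPPORTED, SIGNED-TRANSPOSE-ODD AND DIAGONAL-NULL, AND WHOSE BLOCK SUM IS an1's REMAINDER OF RECORD `symRMAn1 Lc cΛ j`**
# (an1 S2c's SITE law `SymMixedWardSiteLaw.symSiteWardM` unpacked into the `MKer` currency with the block sum `Σ_{v ∈ box}` REMOVED — the (T2-M₂) companion of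
# `CombBorderT2SiteLetter` ((T2-B), exact) and `CombWilsonT2GaugeLetter` ((T2-W), exact))

WHY.  Road «FP»'s graded torus door displays the second-order averaging∕border rows `c2 ∕ d2 ∕ q2`; their torus periodisation (leaf-02's rows lineage) consumes
PER-FINE-SITE letters.  The tree had (T2-M₂) per site only in an1's `KerAt` currency (`symSiteWardM`), and in the `MKer` currency only BLOCK-SUMMED with the
remainder `symRMAn1 := wM1_j • (symWardM − symDatM)` DEFINED as the residual (`SymWardLettersAn1.hM₂_sym`).  This file gives the per-site `MKer` form with the
remainder WRITTEN OUT (no new `def`): §1 the raw site law `divV (symMixFFAt ρ_c … ρ′ w) u₀ = 2·[u₀ = Lc•w + ρ_c] • H − 2 • D∘H` (EXACT; the multiplier bond's ROOT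
indicator and the left leg's rotation — an1's `2·h·([u₀ = root] − [u₀ = x_f])` read on the packed table); §2 the chain's currency: `c_j • divV (M2Of … j … ρ′ w) u₀ =
(wM1_j∕Lc⁴) • (2·[root] • H − 2 • D∘H)` for every `cΛ` (`wM2 = stepScale·wM1`), and AT THE LOCK the commutator form `= comp (M1Of … cΛ j ρ′ w) (diagK (½•legInd)) −
comp (diagK (½•legInd)) (M1Of …) + (wM1_j∕Lc⁴) • R`, `R := 2·[root] • H − comp H D − comp D H`; §3 the remainder's letters: `R` vanishes off the field–field block,
`trK R = −sgnK R` (the (TN) rows' parity class: trace-null against any `F` with `Fᵀ = S·F·S`, W-an2-g39-5 §3′), `R x x a a = 0`; §4 CONSISTENCY WITH THE RECORD: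
`Σ_{v ∈ box} (wM1_j∕Lc⁴) • R(Lc•y + v) = symRMAn1 Lc cΛ j y ρ′ w` at the lock — the per-site remainders SUM to an1's remainder of record.
HONEST: [folklore] unpacking BY NAME of an1's landed site law; the remainder is NOT zero (unlike (T2-B)∕(T2-W)) and is displayed explicitly; nothing of Bałaban's
asserted; not the torus rows; NOT D1, NOT `BetaPertH`, NOT continuum, NOT Clay.  HONEST FRAMING (cell contract, verbatim): «discharging `BetaPertH` makes Bałaban's UV
stability UNCONDITIONAL — a real constructive-QFT result; it is NOT the continuum limit and NOT the Clay problem.»  HONEST DEPENDENCY: continuum YM on T⁴ ⇐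
BetaPertH ∧ nine spine estimates (0/9 proved); BetaPertH ⇐ (D1) ∧ (D4) ∧ CAP+tail; G-an2-4 gates asym, D1 and NE2/3/4.
DERIVED cell leaf ([folklore]; β sub-cell, BINDER-OWNERS row D1 OWNER `b2b-balaban-beta-an2` gen 40).  No `[cite:]`, no `Prop` fact, no `def`.  Provenance: over an1 S2c∕S2d
`SymMixedWardSiteLaw` ∕ `SymMixedWardPacking` ∕ `SymWardLettersAn1` ∕ `SymAveragingMixedJetTables` ∕ `SymAveragingHessianCounts`, leaf-03's `DiagonalContact` BY NAME; no
existing file touched.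
-/

noncomputable section

open Finset
open scoped BigOperators
open Literature.MathematicalPhysics.QuantumFieldTheory
open Literature.MathematicalPhysics.QuantumFieldTheory.Balaban1983to89
open Literature.MathematicalPhysics.QuantumFieldTheory.Balaban1983to89.Beta
open ExpKernelCalculus (MKer comp)
open OneStepResolventKernel (Fib)
open KernelWard (divV)
open AffineAveraging (box toSite)
open AveragingContoursRooted (ctr)
open BalabanStepW2 (M2Of wM1 wM2)
open Summit.QuantumFields.BalabanUV.Beta.TameKernelCalculus (trK trK_apply)
open Summit.QuantumFields.BalabanUV.Beta.BorderedHessian (diagK stepScale stepScale_ne_zero sgnK sgnK_apply sgnF_inl sgnF_inr comp_diagK_left comp_diagK_right)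
open Summit.QuantumFields.BalabanUV.Beta.AveragingWardRootedStencils (legInd legInd_inl legInd_inr)
open Summit.QuantumFields.BalabanUV.Beta.SpineRooted (M1Of M1Of_apply)
open Summit.QuantumFields.BalabanUV.Beta.WardLocusStencils (divV_apply)
open Summit.QuantumFields.BalabanUV.Beta.WardLocusParityLevels (M2Of_apply)
open Summit.QuantumFields.BalabanUV.Beta.SymAveragingHessianCounts (symHessFFAt symHessKerAt symHessFFAt_inl_inl symHessFFAt_inl_inr symHessFFAt_inr
  symHessFFAt_antisymm)
open Summit.QuantumFields.BalabanUV.Beta.SymAveragingMixedJetTables (symMixFFAt symMixKerAt symMixFFAt_inl_inl symMixFFAt_inl_inr symMixFFAt_inr)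
open Summit.QuantumFields.BalabanUV.Beta.SymMixedWardSiteLaw (symSiteWardM)
open Summit.QuantumFields.BalabanUV.Beta.SymMixedWardPacking (symRWof symRWof_apply symWardM_inl_inl symDatM_inl_inl symWardM symDatM symDatM_apply)
open Summit.QuantumFields.BalabanUV.Beta.SymWardLettersAn1 (symRMAn1 wM2_eq hM₂_sym)

namespace Summit.QuantumFields.BalabanUV.Beta.CombMixedT2SiteLetter

variable {Lc : ℕ} [NeZero Lc]

/-! ## §1 The raw site law in the `MKer` currency: root indicator and left-leg rotation, EXACT -/

/-- [folklore] **an1's SITE-LEVEL MIXED WARD LAW ON THE PACKED TABLE, PER FINE SITE, EXACT** (root `ρ_c = ctr 4 Lc`; `H := symHessFFAt ρ_c Lc ρ′ w`,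
`D := diagK (legInd ρ_c u₀)`): `divV (fun κ u => symMixFFAt ρ_c Lc κ u ρ′ w) u₀ = (2·[u₀ = Lc•w + ρ_c]) • H − 2 • comp D H` — the multiplier bond's ROOT indicator
and the LEFT field leg's rotation (`symSiteWardM`: `Σ_κ (t(κ,u₀−e_κ) − t(κ,u₀))(f,f′) = 2·h(f,f′)·([u₀ = Lc•w + ρ_c] − [u₀ = x_f])`); both sides field–field supported. -/
theorem divV_symMixFFAt_site (ρ' : Fin 4) (w u₀ : Fin 4 → ℤ) :
    divV (fun κ u => symMixFFAt (ctr 4 Lc) Lc κ u ρ' w) u₀ =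
      (2 * (if u₀ = (Lc : ℤ) • w + ctr 4 Lc then (1 : ℝ) else 0)) • symHessFFAt (ctr 4 Lc) Lc ρ' w
        - (2 : ℝ) • comp (diagK (legInd (ctr 4 Lc) u₀)) (symHessFFAt (ctr 4 Lc) Lc ρ' w) := by
  funext x z a b
  rw [divV_apply, Pi.sub_apply, Pi.sub_apply, Pi.sub_apply, Pi.sub_apply, Pi.smul_apply, Pi.smul_apply, Pi.smul_apply, Pi.smul_apply, smul_eq_mul,
    Pi.smul_apply, Pi.smul_apply, Pi.smul_apply, Pi.smul_apply, smul_eq_mul, comp_diagK_left]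
  rcases a with β | m <;> rcases b with β' | m'
  · simp only [symMixFFAt_inl_inl, symHessFFAt_inl_inl, legInd_inl]
    rw [symSiteWardM (Lc := Lc) u₀ ρ' w β x β' z]
    have e : (if u₀ = x then (1 : ℝ) else 0) = (if x = u₀ then (1 : ℝ) else 0) := by simp only [eq_comm]
    rw [e]
    ring
  · simp only [symMixFFAt_inl_inr, symHessFFAt_inl_inr, sub_self, Finset.sum_const_zero, mul_zero]
  · simp only [symMixFFAt_inr, symHessFFAt_inr, sub_self, Finset.sum_const_zero, mul_zero]
  · simp only [symMixFFAt_inr, symHessFFAt_inr, sub_self, Finset.sum_const_zero, mul_zero]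

/-! ## §2 The chain's currency: `c_j • divV (M2Of … j)`, every `cΛ`; the commutator form with the explicit remainder at the Λ-lock -/

/-- [folklore] **(T2-M₂) PER FINE SITE, RAW FORM, EVERY LEVEL AND EVERY `cΛ`** (`c_j = (stepScale 3 Lc j·Lc⁴)⁻¹`, `wM2_j = stepScale_j·wM1_j`):
`c_j • divV (fun κ u => M2Of 3 Lc (symMixFFAt ρ_c Lc) j κ u ρ′ w) u₀ = (wM1_j∕Lc⁴) • ((2·[u₀ = Lc•w + ρ_c]) • H − 2 • comp D H)`. -/
theorem divV_mixedT2_site_raw (j : ℕ) (ρ' : Fin 4) (w u₀ : Fin 4 → ℤ) :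
    (stepScale 3 Lc j * (Lc : ℝ) ^ (3 + 1))⁻¹ • divV (fun κ u => M2Of 3 Lc (symMixFFAt (ctr 4 Lc) Lc) j κ u ρ' w) u₀ =
      (wM1 3 Lc j / (Lc : ℝ) ^ 4) •
        ((2 * (if u₀ = (Lc : ℤ) • w + ctr 4 Lc then (1 : ℝ) else 0)) • symHessFFAt (ctr 4 Lc) Lc ρ' w
          - (2 : ℝ) • comp (diagK (legInd (ctr 4 Lc) u₀)) (symHessFFAt (ctr 4 Lc) Lc ρ' w)) := by
  have hs : stepScale 3 Lc j ≠ 0 := stepScale_ne_zero j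
  have e : (fun κ u => M2Of 3 Lc (symMixFFAt (ctr 4 Lc) Lc) j κ u ρ' w) = fun κ u => wM2 3 Lc j • symMixFFAt (ctr 4 Lc) Lc κ u ρ' w := by
    funext κ u; rw [M2Of_apply]
  have hdiv : divV (fun κ u => wM2 3 Lc j • symMixFFAt (ctr 4 Lc) Lc κ u ρ' w) u₀ = wM2 3 Lc j • divV (fun κ u => symMixFFAt (ctr 4 Lc) Lc κ u ρ' w) u₀ := by
    funext x z a b
    rw [divV_apply, Pi.smul_apply, Pi.smul_apply, Pi.smul_apply, Pi.smul_apply, smul_eq_mul, divV_apply, Finset.mul_sum]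
    refine Finset.sum_congr rfl fun κ _ => ?_
    rw [Pi.smul_apply, Pi.smul_apply, Pi.smul_apply, Pi.smul_apply, smul_eq_mul, Pi.smul_apply, Pi.smul_apply, Pi.smul_apply, Pi.smul_apply, smul_eq_mul]
    ring
  rw [e, hdiv, divV_symMixFFAt_site, smul_smul, wM2_eq]
  congr 1
  rw [show (3 + 1 : ℕ) = 4 from rfl]
  field_simp

/-- [folklore] **(T2-M₂) PER FINE SITE AT THE Λ-LOCK `cΛ·Lc⁴ = 2`, COMMUTATOR FORM WITH THE EXPLICIT REMAINDER** (generator `½ • legInd ρ_c u₀` and multiplier table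
`M1Of 3 Lc (symHessFFAt ρ_c Lc) cΛ j` exactly as in `SymWardLettersAn1.hM₂_sym`, the block sum removed):
`c_j • divV (M2Of … j … ρ′ w) u₀ = comp (M1Of … cΛ j ρ′ w) (diagK (½ • legInd ρ_c u₀)) − comp (diagK (½ • legInd ρ_c u₀)) (M1Of … cΛ j ρ′ w) + (wM1_j∕Lc⁴) • R`,
`R := (2·[u₀ = Lc•w + ρ_c]) • H − comp H D − comp D H`, `D = diagK (legInd ρ_c u₀)`. -/
theorem divV_mixedT2_site_of_lock {cΛ : ℝ} (hΛ : cΛ * (Lc : ℝ) ^ 4 = 2) (j : ℕ) (ρ' : Fin 4) (w u₀ : Fin 4 → ℤ) :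
    (stepScale 3 Lc j * (Lc : ℝ) ^ (3 + 1))⁻¹ • divV (fun κ u => M2Of 3 Lc (symMixFFAt (ctr 4 Lc) Lc) j κ u ρ' w) u₀ =
      comp (M1Of 3 Lc (symHessFFAt (ctr 4 Lc) Lc) cΛ j ρ' w) (diagK ((1 / 2 : ℝ) • legInd (ctr 4 Lc) u₀))
        - comp (diagK ((1 / 2 : ℝ) • legInd (ctr 4 Lc) u₀)) (M1Of 3 Lc (symHessFFAt (ctr 4 Lc) Lc) cΛ j ρ' w)
        + (wM1 3 Lc j / (Lc : ℝ) ^ 4) •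
            ((2 * (if u₀ = (Lc : ℤ) • w + ctr 4 Lc then (1 : ℝ) else 0)) • symHessFFAt (ctr 4 Lc) Lc ρ' w
              - comp (symHessFFAt (ctr 4 Lc) Lc ρ' w) (diagK (legInd (ctr 4 Lc) u₀))
              - comp (diagK (legInd (ctr 4 Lc) u₀)) (symHessFFAt (ctr 4 Lc) Lc ρ' w)) := by
  have hL : (Lc : ℝ) ≠ 0 := Nat.cast_ne_zero.2 (NeZero.ne Lc)
  have hc : cΛ = 2 / (Lc : ℝ) ^ 4 := by
    rw [eq_div_iff (pow_ne_zero _ hL)]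
    exact hΛ
  rw [divV_mixedT2_site_raw]
  funext x z a b
  simp only [Pi.smul_apply, Pi.sub_apply, Pi.add_apply, smul_eq_mul, comp_diagK_left, comp_diagK_right, M1Of_apply, hc]
  ring

/-! ## §3 The per-site remainder's letters: field–field support, signed-transpose parity, diagonal-null -/

omit [NeZero Lc] in
/-- [folklore] **THE REMAINDER IS FIELD–FIELD SUPPORTED** — it vanishes on `(inl, inr)` … -/
theorem remainder_inl_inr (ρ' : Fin 4) (w u₀ x z : Fin 4 → ℤ) (β m : Fin 4) :
    ((2 * (if u₀ = (Lc : ℤ) • w + ctr 4 Lc then (1 : ℝ) else 0)) • symHessFFAt (ctr 4 Lc) Lc ρ' w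
        - comp (symHessFFAt (ctr 4 Lc) Lc ρ' w) (diagK (legInd (ctr 4 Lc) u₀))
        - comp (diagK (legInd (ctr 4 Lc) u₀)) (symHessFFAt (ctr 4 Lc) Lc ρ' w)) x z (Sum.inl β) (Sum.inr m) = 0 := by
  rw [Pi.sub_apply, Pi.sub_apply, Pi.sub_apply, Pi.sub_apply, Pi.sub_apply, Pi.sub_apply, Pi.sub_apply, Pi.sub_apply, Pi.smul_apply, Pi.smul_apply,
    Pi.smul_apply, Pi.smul_apply, smul_eq_mul, comp_diagK_right, comp_diagK_left, symHessFFAt_inl_inr]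
  ring

omit [NeZero Lc] in
/-- [folklore] … and on `(inr, ·)`. -/
theorem remainder_inr (ρ' : Fin 4) (w u₀ x z : Fin 4 → ℤ) (m : Fin 4) (b : Fib 3) :
    ((2 * (if u₀ = (Lc : ℤ) • w + ctr 4 Lc then (1 : ℝ) else 0)) • symHessFFAt (ctr 4 Lc) Lc ρ' w
        - comp (symHessFFAt (ctr 4 Lc) Lc ρ' w) (diagK (legInd (ctr 4 Lc) u₀))
        - comp (diagK (legInd (ctr 4 Lc) u₀)) (symHessFFAt (ctr 4 Lc) Lc ρ' w)) x z (Sum.inr m) b = 0 := by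
  rw [Pi.sub_apply, Pi.sub_apply, Pi.sub_apply, Pi.sub_apply, Pi.sub_apply, Pi.sub_apply, Pi.sub_apply, Pi.sub_apply, Pi.smul_apply, Pi.smul_apply,
    Pi.smul_apply, Pi.smul_apply, smul_eq_mul, comp_diagK_right, comp_diagK_left, symHessFFAt_inr]
  ring

omit [NeZero Lc] in
/-- [folklore] **THE REMAINDER IS SIGNED-TRANSPOSE-ODD** (`trK R = −sgnK R`: the (TN) parity class of `SymWardLettersAn1.hRMp_sym_of_lock`, per site) — from the
antisymmetry of `symHessFFAt` (`symHessFFAt_antisymm`); the root indicator and the symmetrised rotation `H∘D + D∘H` preserve it. -/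
theorem trK_remainder (ρ' : Fin 4) (w u₀ : Fin 4 → ℤ) :
    trK ((2 * (if u₀ = (Lc : ℤ) • w + ctr 4 Lc then (1 : ℝ) else 0)) • symHessFFAt (ctr 4 Lc) Lc ρ' w
        - comp (symHessFFAt (ctr 4 Lc) Lc ρ' w) (diagK (legInd (ctr 4 Lc) u₀))
        - comp (diagK (legInd (ctr 4 Lc) u₀)) (symHessFFAt (ctr 4 Lc) Lc ρ' w)) =
      -sgnK ((2 * (if u₀ = (Lc : ℤ) • w + ctr 4 Lc then (1 : ℝ) else 0)) • symHessFFAt (ctr 4 Lc) Lc ρ' w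
        - comp (symHessFFAt (ctr 4 Lc) Lc ρ' w) (diagK (legInd (ctr 4 Lc) u₀))
        - comp (diagK (legInd (ctr 4 Lc) u₀)) (symHessFFAt (ctr 4 Lc) Lc ρ' w)) := by
  funext x z a b
  simp only [trK_apply, Pi.neg_apply, sgnK_apply, Pi.sub_apply, Pi.smul_apply, smul_eq_mul, comp_diagK_right, comp_diagK_left]
  rw [symHessFFAt_antisymm (ctr 4 Lc) Lc ρ' w x z a b]
  rcases a with β | m <;> rcases b with β' | m'
  · rw [sgnF_inl, sgnF_inl]
    ring
  · rw [symHessFFAt_inl_inr]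
    ring
  · rw [symHessFFAt_inr]
    ring
  · rw [symHessFFAt_inr]
    ring

omit [NeZero Lc] in
/-- [folklore] **THE REMAINDER IS DIAGONAL-NULL, ENTRYWISE** (`R x x a a = 0`: `symHessFFAt` is antisymmetric, so its diagonal vanishes) — the trace rows of the
road's (TN) branch see nothing of it on the diagonal. -/
theorem remainder_diag (ρ' : Fin 4) (w u₀ x : Fin 4 → ℤ) (a : Fib 3) :
    ((2 * (if u₀ = (Lc : ℤ) • w + ctr 4 Lc then (1 : ℝ) else 0)) • symHessFFAt (ctr 4 Lc) Lc ρ' w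
        - comp (symHessFFAt (ctr 4 Lc) Lc ρ' w) (diagK (legInd (ctr 4 Lc) u₀))
        - comp (diagK (legInd (ctr 4 Lc) u₀)) (symHessFFAt (ctr 4 Lc) Lc ρ' w)) x x a a = 0 := by
  have h0 : symHessFFAt (ctr 4 Lc) Lc ρ' w x x a a = 0 := by
    have h := symHessFFAt_antisymm (ctr 4 Lc) Lc ρ' w x x a a
    linarith
  simp only [Pi.sub_apply, Pi.smul_apply, smul_eq_mul, comp_diagK_right, comp_diagK_left, h0, mul_zero, zero_mul, sub_self]

/-! ## §4 Consistency with the record: the per-site remainders SUM to an1's `symRMAn1` over the block (at the Λ-lock) -/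

/-- [folklore] **THE BLOCK SUM OF THE PER-SITE REMAINDER IS an1's REMAINDER OF RECORD** (at the Λ-lock `cΛ·Lc⁴ = 2`, every level `j`, coarse site `y`,
multiplier bond `(ρ′, w)`): `Σ_{v ∈ box} (wM1_j∕Lc⁴) • R(Lc•y + v) = symRMAn1 Lc cΛ j y ρ′ w` (`symRMAn1 = wM1_j • (symWardM − symDatM)`, `SymWardLettersAn1` §2; entrywise from
`symWardM_inl_inl`, `symDatM_inl_inl` and the site law). -/
theorem sum_remainder_eq_symRMAn1 {cΛ : ℝ} (hΛ : cΛ * (Lc : ℝ) ^ 4 = 2) (j : ℕ) (y : Fin 4 → ℤ) (ρ' : Fin 4) (w : Fin 4 → ℤ) :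
    ∑ v ∈ box (3 + 1) Lc, (wM1 3 Lc j / (Lc : ℝ) ^ 4) •
        ((2 * (if (Lc : ℤ) • y + toSite v = (Lc : ℤ) • w + ctr 4 Lc then (1 : ℝ) else 0)) • symHessFFAt (ctr 4 Lc) Lc ρ' w
          - comp (symHessFFAt (ctr 4 Lc) Lc ρ' w) (diagK (legInd (ctr 4 Lc) ((Lc : ℤ) • y + toSite v)))
          - comp (diagK (legInd (ctr 4 Lc) ((Lc : ℤ) • y + toSite v))) (symHessFFAt (ctr 4 Lc) Lc ρ' w)) =
      symRMAn1 Lc cΛ j y ρ' w := by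
  funext x z a b
  have hrec := congrFun (congrFun (congrFun (congrFun (hM₂_sym (Lc := Lc) cΛ j y ρ' w) x) z) a) b
  have hsite := fun v : Fin (3 + 1) → ℕ =>
    congrFun (congrFun (congrFun (congrFun (divV_mixedT2_site_of_lock (Lc := Lc) hΛ j ρ' w ((Lc : ℤ) • y + toSite v)) x) z) a) b
  simp only [Pi.add_apply, Pi.sub_apply, Pi.smul_apply, Finset.sum_apply, smul_eq_mul, comp_diagK_right, comp_diagK_left, Finset.mul_sum,
    Finset.sum_mul] at hrec hsite ⊢
  rw [Finset.sum_congr rfl fun v _ => hsite v] at hrec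
  simp only [Finset.sum_add_distrib, Finset.sum_sub_distrib] at hrec
  linarith [hrec]

end Summit.QuantumFields.BalabanUV.Beta.CombMixedT2SiteLetter

end
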